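import Mathlib

/-!
# T5IntegralBookkeeping — the measure bookkeeping of T5-ID §ID-4(b′) (pub-hodge-repro2, seat p2)

Step ID-4(b′) of `route/T5-ID-p2.md` (Tier 5, sub-step N1) converts the Hodge inner product of two
(2,0)-forms on the compact surface `S = ⊔_j Γ_j\𝔹²` into the `L²`-pairing of automorphic
functions on `[G] = G(F⁺)\G(𝔸)` through four bookkeeping identities, kernel-checked here in the
abstract (nothing automorphic is formalised; the adelic input — that `[G]/K` is the finite
disjoint union of the `Γ_j\G_∞`, i.e. the finiteness of `G(F⁺)\G(𝔸_f)/K` for the compact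
`[G]` — is the prose's cited fact and is modelled by the decomposition hypothesis `hνY`):

* (descent) a function on `Γ\G₁` that factors through the projection `π : Γ\G₁ → Γ\𝔹² = Γ\G₁/K₁`
  has the same integral against `dg_∞` as its descent against the push-forward `π_* dg_∞`
  (`= Vol_h` by the normalisation of `dg_∞`): `integral_comp_eq_integral_map`,
  `integral_comp_eq_of_map_eq`;
* (components) the integral over a finite measurable partition is the sum over the pieces
  (`S = ⊔_j Γ_j\𝔹²`): `integral_eq_sum_of_partition`;
* (the compact factor) on `A × K` with a finite measure `ν` on `K`, a function constant along `K`
  integrates to `ν(K) · ∫_A φ`: `integral_fst_eq_measure_smul`;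
* (assembly) if the measure of `Y` (= `[G]` seen through right-`K`-invariant functions) is the sum
  of the push-forwards of the product measures `μ_j × ν` along maps `ι_j : A_j × K → Y`, then a
  measurable `Φ` with `Φ (ι_j (a, k)) = φ_j a` integrates to `ν(K) · Σ_j ∫_{A_j} φ_j` — the
  identity `∫_{[G]} Φ dg = vol(K, dg_f) · Σ_j ∫_{Γ_j\G_∞} Φ_j dg_∞` of ID-4(b′):
  `integral_eq_measure_smul_sum`, and its inversion with `c_K := vol(K)⁻¹`:
  `sum_integral_eq_inv_measure_smul`.
-/

namespace Summit.Ventures.HodgeRepro2.T5IntegralBookkeeping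

open MeasureTheory Set Function

section descent

variable {G X : Type*} [MeasurableSpace G] [MeasurableSpace X]

/-- ID-4(b′) descent: for an a.e.-measurable projection `π : G → X` and a function `f` on `X`
(a.e. strongly measurable for the push-forward measure), `∫_G f ∘ π dμ = ∫_X f d(π_*μ)`. -/
theorem integral_comp_eq_integral_map (μ : Measure G) {π : G → X} (hπ : AEMeasurable π μ)
    {f : X → ℂ} (hf : AEStronglyMeasurable f (μ.map π)) :
    ∫ g, f (π g) ∂μ = ∫ x, f x ∂(μ.map π) :=
  (integral_map hπ hf).symm

/-- The same with the normalisation of ID-4(b′) made explicit: if the push-forward of `μ` (the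
Haar measure `dg_∞` on `Γ\G₁`) along `π` is the prescribed volume measure `vol` on `X` (`Vol_h` on
`Γ\𝔹²`), then integrating `f ∘ π` against `μ` is integrating `f` against `vol`. -/
theorem integral_comp_eq_of_map_eq (μ : Measure G) {π : G → X} (hπ : Measurable π)
    {vol : Measure X} (hvol : μ.map π = vol) {f : X → ℂ} (hf : Measurable f) :
    ∫ g, f (π g) ∂μ = ∫ x, f x ∂vol := by
  subst hvol
  exact integral_comp_eq_integral_map μ hπ.aemeasurable hf.aestronglyMeasurable

end descent

section partition

variable {Y : Type*} [MeasurableSpace Y] {J : Type*} [Fintype J]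

/-- ID-4(b′) components: if `Y = ⊔_j A j` is a finite measurable partition (the components
`Γ_j\𝔹²` of `S`), the integral of an integrable `Φ` over `Y` is the sum of the integrals over
the pieces. -/
theorem integral_eq_sum_of_partition (ν : Measure Y) {A : J → Set Y}
    (hA : ∀ j, MeasurableSet (A j)) (hdisj : Pairwise (Disjoint on A))
    (hcover : ⋃ j, A j = univ) {Φ : Y → ℂ} (hΦ : Integrable Φ ν) :
    ∫ y, Φ y ∂ν = ∑ j, ∫ y in A j, Φ y ∂ν := by
  rw [← setIntegral_univ, ← hcover]
  exact integral_iUnion_fintype hA hdisj fun j => hΦ.integrableOn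

end partition

section compactFactor

variable {A K : Type*} [MeasurableSpace A] [MeasurableSpace K]

/-- ID-4(b′) compact factor: a function on `A × K` depending only on the first coordinate
integrates against `μ.prod ν` to `ν(K) · ∫_A φ dμ` (the volume of the level group `K`, for the
product measure `dg = dg_∞ × dg_f`). -/
theorem integral_fst_eq_measure_smul (μ : Measure A) [SFinite μ] (ν : Measure K) [SFinite ν]
    (φ : A → ℂ) :
    ∫ p : A × K, φ p.1 ∂(μ.prod ν) = ν.real univ • ∫ a, φ a ∂μ :=
  integral_fun_fst φ

end compactFactor

section assembly

variable {J : Type*} [Fintype J] {A : J → Type*} [∀ j, MeasurableSpace (A j)]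
  {K : Type*} [MeasurableSpace K] {Y : Type*} [MeasurableSpace Y]

/-- ID-4(b′) assembly: `Y` carries the sum of the push-forwards of the product measures
`μ_j × ν` along `ι_j : A_j × K → Y` (the pieces `Γ_j\G_∞ × K` of `[G]`); a measurable `Φ` on `Y`
with `Φ (ι_j (a, k)) = φ_j a` (right-`K`-invariance, with `Φ_j := Φ(· g_j)` the restriction to the
`j`-th component) and integrable `φ_j` satisfies
`∫_Y Φ = ν(K) · Σ_j ∫_{A_j} φ_j` — the identity `∫_{[G]} Φ dg = vol(K, dg_f) · Σ_j ∫_{Γ_j\G_∞} Φ_j dg_∞`. -/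
theorem integral_eq_measure_smul_sum (μ : ∀ j, Measure (A j)) [∀ j, SFinite (μ j)]
    (ν : Measure K) [IsFiniteMeasure ν] {ι : ∀ j, A j × K → Y} (hι : ∀ j, Measurable (ι j))
    {νY : Measure Y} (hνY : νY = ∑ j, ((μ j).prod ν).map (ι j))
    {Φ : Y → ℂ} (hΦm : Measurable Φ) {φ : ∀ j, A j → ℂ} (hφ : ∀ j, Integrable (φ j) (μ j))
    (hΦ : ∀ j p, Φ (ι j p) = φ j p.1) :
    ∫ y, Φ y ∂νY = ν.real univ • ∑ j, ∫ a, φ j a ∂(μ j) := by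
  have hint : ∀ j ∈ (Finset.univ : Finset J), Integrable Φ (((μ j).prod ν).map (ι j)) := by
    intro j _
    rw [integrable_map_measure hΦm.aestronglyMeasurable (hι j).aemeasurable]
    have hcomp : Φ ∘ ι j = fun p => φ j p.1 := funext fun p => hΦ j p
    rw [hcomp]
    exact (hφ j).comp_fst ν
  rw [hνY, integral_finsetSum_measure hint, Finset.smul_sum]
  refine Finset.sum_congr rfl fun j _ => ?_
  rw [integral_map (hι j).aemeasurable hΦm.aestronglyMeasurable]
  simp_rw [hΦ j]
  exact integral_fun_fst (φ j)

/-- The inversion used in ID-4(b′): with `c_K := ν(K)⁻¹` (positive once `ν(K) ≠ 0`),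
`Σ_j ∫_{A_j} φ_j = c_K · ∫_Y Φ` — the form `∫_S ω ∧ \overline{ω′} = c_K ⟨F_ω, F_{ω′}⟩_{L²([G])}`. -/
theorem sum_integral_eq_inv_measure_smul (μ : ∀ j, Measure (A j)) [∀ j, SFinite (μ j)]
    (ν : Measure K) [IsFiniteMeasure ν] (hν : ν.real univ ≠ 0) {ι : ∀ j, A j × K → Y}
    (hι : ∀ j, Measurable (ι j)) {νY : Measure Y} (hνY : νY = ∑ j, ((μ j).prod ν).map (ι j))
    {Φ : Y → ℂ} (hΦm : Measurable Φ) {φ : ∀ j, A j → ℂ} (hφ : ∀ j, Integrable (φ j) (μ j))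
    (hΦ : ∀ j p, Φ (ι j p) = φ j p.1) :
    ∑ j, ∫ a, φ j a ∂(μ j) = (ν.real univ)⁻¹ • ∫ y, Φ y ∂νY := by
  rw [integral_eq_measure_smul_sum μ ν hι hνY hΦm hφ hΦ, smul_smul, inv_mul_cancel₀ hν, one_smul]

/-- The constant `c_K = ν(K)⁻¹` is positive when `ν(K) > 0` (ID-4(b′): «c_K > 0»). -/
theorem inv_measure_pos (ν : Measure K) [IsFiniteMeasure ν] (hν : 0 < ν.real univ) :
    0 < (ν.real univ)⁻¹ :=
  inv_pos.mpr hν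

end assembly

end Summit.Ventures.HodgeRepro2.T5IntegralBookkeeping
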